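import Mathlib
import HarnessLib
import Summits.Ventures.LatticeQCDFlow.Exactness.SelfTunedFlowChoiceBias

/-!
# LatticeQCDFlow / Exactness — LEARNING ON THE JOB, XII: THE ECHO — training a walker's flow on ANOTHER walker's HISTORY is biased even
# with one-at-a-time updates, because the other walker's history has read this walker's past (two-walker, two-step witness `3/4 ↦ 53/72`)

HONEST FRAMING: exact (Metropolis-corrected) sampling algorithms for lattice gauge theory;
figures of merit are autocorrelation/cost numbers at stated couplings and volumes; no
continuum-physics claim.

Venture `LatticeQCDFlow` (cell pub-lqcd), topic `Exactness`, FANOUT row 30 (lean-1 GEN-44, theme LEARNING ON THE JOB).  The limit of the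
leave-one-out rule (`PopulationLeaveOneOutExact`, `PopulationSiteUpdateExact`): there each walker reads the other walkers' CURRENT states and
the product target is invariant; here walker B reads a statistic of walker A's TRAJECTORY, and A's trajectory was generated reading B — so
the statistic carries information about B's own current state back to B (an echo), and B's update is a state-dependent choice of flow in
disguise (`SelfTunedFlowChoiceBias` ∕ `SelfTunedSoftMixtureBias`).  NEW WORK of the cell; no definition is introduced, nothing is cited as a
fact.  Tree inputs: the `Bool` bookkeeping of `IMHNaiveRetryBias` ∕ `SelfTunedFlowChoiceBias`.

## The witness
Two walkers A, B on `Bool`, common target `π = w·q` (`q` uniform, `w = (1, 2)`: `π({false}) = 1/2`, `π({true}) = 1`), two exact samplers: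
`P₀` = the uniform-flow sampler `indepMH q w`, `P₁` = the perfect-flow sampler (`q₁ = (1/3, 2/3)`, always accepts).  Start from `π ⊗ π`.
STEP 1 (A moves, reading B's current state — exact by the leave-one-out rule): A uses `P₀` if `x_B = false`, `P₁` if `x_B = true`; the
triple `(x_A, x_A', x_B)` is recorded (def-free kernel `K₁`, hypotheses `hK₁f`, `hK₁t`).  STEP 2 (B moves, reading A's HISTORY): B uses the
perfect flow `P₁` if A STAYED (`x_A = x_A'`) and `P₀` if A moved (kernel `K₂`, hypotheses `hK₂s`, `hK₂m`) — "fit B's proposal to how A has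
been behaving".  Each constituent is exact and B's CHOICE of flow never reads B's own state; yet:

## Results (no `sorry`)
* §1 bookkeeping: `EchoWitness.P₀_apply_true`, `EchoWitness.P₁_apply_true`, `EchoWitness.stepTwo_apply` (the four values of
  `∫ K₂(a, a', b)({false}) P_b(a)(da')`: `5/12, 3/8, 5/18, 11/36`).
* §2 **`echo_bind_apply_false`** — after the two steps walker B sits at `false` with mass `53/72`, against `(π ⊗ π)(Ω × {false}) = 3/4 =
  54/72` (`echo_target_false`) if the scheme were exact; **`echo_biased`** — the two differ: A's holding statistic is more likely after A
  used `P₀`, i.e. after `x_B = false`, so B's flow choice is correlated with B's own state.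
Reading (gauge files): in population training, fitting walker `i`'s flow to the other walkers' PAST samples is not covered by the
leave-one-out theorem and is biased in general (the others' pasts were generated reading walker `i`); fit to their current states, or keep
the lag ∕ defensive envelope of `LaggedAdaptationDoeblin` ∕ `AdaptiveFlowDefensiveEnvelope`, or train on walkers that never read walker `i`
(`PopulationSimultaneousBias` §1, `ExogenousAdaptationExact`).
-/

namespace Summit.Ventures.LatticeQCDFlow.Exactness

open MeasureTheory ProbabilityTheory
open scoped _root_.ENNReal

section EchoWitness

variable {q q₁ : Measure Bool} {w : Bool → ℝ}

/-! ## §1 Bookkeeping: the two samplers' one-step probabilities -/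

/-- `P₀(false, {true}) = 1/2`, `P₀(true, {true}) = 3/4`. [ours, bookkeeping] -/
theorem EchoWitness.P₀_apply_true (hq : ∀ b, q {b} = ENNReal.ofReal 2⁻¹) (hwf : w false = 1) (hwt : w true = 2) (P₀ : Kernel Bool Bool)
    (hP₀ : ∀ (x : Bool) {B : Set Bool}, MeasurableSet B → P₀ x B =
      ∫⁻ y in B, imhAcceptE w x y ∂q + (1 - imhAcceptMass q w x) * B.indicator 1 x) :
    P₀ false {true} = ENNReal.ofReal 2⁻¹ ∧ P₀ true {true} = ENNReal.ofReal (3 / 4) := by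
  obtain ⟨-, hft, -, htt⟩ := NaiveRetryWitness.imhAcceptE_eq hwf hwt
  obtain ⟨-, hAt⟩ := NaiveRetryWitness.imhAcceptMass_eq hq hwf hwt
  constructor
  · rw [hP₀ false (measurableSet_singleton _), lintegral_singleton, hft, hq, Set.indicator_of_notMem (by simp), mul_zero, add_zero,
      one_mul]
  · rw [hP₀ true (measurableSet_singleton _), lintegral_singleton, htt, hq, hAt, Set.indicator_of_mem (Set.mem_singleton _),
      Pi.one_apply, mul_one, one_mul, ← ENNReal.ofReal_one, ← ENNReal.ofReal_sub _ (by norm_num),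
      ← ENNReal.ofReal_add (by norm_num) (by norm_num)]
    norm_num

/-- `P₁(x, {true}) = 2/3`. [ours, bookkeeping] -/
theorem EchoWitness.P₁_apply_true (hq₁t : q₁ {true} = ENNReal.ofReal (2 / 3)) [IsProbabilityMeasure q₁] (P₁ : Kernel Bool Bool)
    (hP₁ : ∀ (x : Bool) {B : Set Bool}, MeasurableSet B → P₁ x B =
      ∫⁻ y in B, imhAcceptE (fun _ : Bool => (3 / 2 : ℝ)) x y ∂q₁ + (1 - imhAcceptMass q₁ (fun _ : Bool => (3 / 2 : ℝ)) x) * B.indicator 1 x)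
    (x : Bool) : P₁ x {true} = ENNReal.ofReal (2 / 3) := by
  rw [SelfTunedWitness.perfect_apply P₁ hP₁ x (measurableSet_singleton _), hq₁t]

/-- **STEP 2 AVERAGED OVER STEP 1**: `∫ K₂(a, a', b)({false}) P_b(a)(da')` for the four `(a, b)`: `(false, false) ↦ 5/12`,
`(true, false) ↦ 3/8`, `(false, true) ↦ 5/18`, `(true, true) ↦ 11/36`. [ours, bookkeeping] -/
theorem EchoWitness.stepTwo_apply (hq : ∀ b, q {b} = ENNReal.ofReal 2⁻¹) (hwf : w false = 1) (hwt : w true = 2)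
    (hq₁f : q₁ {false} = ENNReal.ofReal 3⁻¹) (hq₁t : q₁ {true} = ENNReal.ofReal (2 / 3)) [IsProbabilityMeasure q₁]
    (P₀ P₁ : Kernel Bool Bool)
    (hP₀ : ∀ (x : Bool) {B : Set Bool}, MeasurableSet B → P₀ x B =
      ∫⁻ y in B, imhAcceptE w x y ∂q + (1 - imhAcceptMass q w x) * B.indicator 1 x)
    (hP₁ : ∀ (x : Bool) {B : Set Bool}, MeasurableSet B → P₁ x B =
      ∫⁻ y in B, imhAcceptE (fun _ : Bool => (3 / 2 : ℝ)) x y ∂q₁ + (1 - imhAcceptMass q₁ (fun _ : Bool => (3 / 2 : ℝ)) x) * B.indicator 1 x)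
    (K₂ : Kernel (Bool × Bool × Bool) Bool) (hK₂s : ∀ (a b : Bool) {B : Set Bool}, MeasurableSet B → K₂ (a, a, b) B = P₁ b B)
    (hK₂m : ∀ (a a' b : Bool) {B : Set Bool}, MeasurableSet B → a ≠ a' → K₂ (a, a', b) B = P₀ b B) :
    ∫⁻ a', K₂ (false, a', false) {false} ∂(P₀ false) = ENNReal.ofReal (5 / 12) ∧
      ∫⁻ a', K₂ (true, a', false) {false} ∂(P₀ true) = ENNReal.ofReal (3 / 8) ∧
      ∫⁻ a', K₂ (false, a', true) {false} ∂(P₁ false) = ENNReal.ofReal (5 / 18) ∧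
      ∫⁻ a', K₂ (true, a', true) {false} ∂(P₁ true) = ENNReal.ofReal (11 / 36) := by
  have hs : MeasurableSet ({false} : Set Bool) := measurableSet_singleton _
  obtain ⟨h0ff, h0tf⟩ := SelfTunedWitness.uniform_apply_false hq hwf hwt P₀ hP₀
  obtain ⟨h0ft, h0tt⟩ := EchoWitness.P₀_apply_true hq hwf hwt P₀ hP₀
  have h1f : ∀ x, P₁ x {false} = ENNReal.ofReal 3⁻¹ := SelfTunedWitness.perfect_apply_false hq₁f P₁ hP₁
  have h1t : ∀ x, P₁ x {true} = ENNReal.ofReal (2 / 3) := EchoWitness.P₁_apply_true hq₁t P₁ hP₁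
  -- the second-stage values: stay ⇒ perfect flow (`1/3`), move ⇒ uniform flow (`1/2` from `false`, `1/4` from `true`)
  have hsF : ∀ a, K₂ (a, a, false) {false} = ENNReal.ofReal 3⁻¹ := fun a => by rw [hK₂s a false hs, h1f]
  have hsT : ∀ a, K₂ (a, a, true) {false} = ENNReal.ofReal 3⁻¹ := fun a => by rw [hK₂s a true hs, h1f]
  have hmF : ∀ a a', a ≠ a' → K₂ (a, a', false) {false} = ENNReal.ofReal 2⁻¹ := fun a a' h => by rw [hK₂m a a' false hs h, h0ff]
  have hmT : ∀ a a', a ≠ a' → K₂ (a, a', true) {false} = ENNReal.ofReal 4⁻¹ := fun a a' h => by rw [hK₂m a a' true hs h, h0tf]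
  refine ⟨?_, ?_, ?_, ?_⟩
  · rw [lintegral_fintype, Fintype.sum_bool, hmF false true (by decide), hsF, h0ft, h0ff, ← ENNReal.ofReal_mul (by norm_num),
      ← ENNReal.ofReal_mul (by norm_num), ← ENNReal.ofReal_add (by norm_num) (by norm_num)]
    norm_num
  · rw [lintegral_fintype, Fintype.sum_bool, hsF, hmF true false (by decide), h0tt, h0tf, ← ENNReal.ofReal_mul (by norm_num),
      ← ENNReal.ofReal_mul (by norm_num), ← ENNReal.ofReal_add (by norm_num) (by norm_num)]
    norm_num
  · rw [lintegral_fintype, Fintype.sum_bool, hmT false true (by decide), hsT, h1t, h1f, ← ENNReal.ofReal_mul (by norm_num),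
      ← ENNReal.ofReal_mul (by norm_num), ← ENNReal.ofReal_add (by norm_num) (by norm_num)]
    norm_num
  · rw [lintegral_fintype, Fintype.sum_bool, hsT, hmT true false (by decide), h1t, h1f, ← ENNReal.ofReal_mul (by norm_num),
      ← ENNReal.ofReal_mul (by norm_num), ← ENNReal.ofReal_add (by norm_num) (by norm_num)]
    norm_num

/-! ## §2 The echo: two exact steps, the second reading the first walker's history, bias the second walker -/

/-- **THE ECHO, QUANTIFIED**: from `π ⊗ π`, after STEP 1 (A moves reading B's current state, history recorded) and STEP 2 (B moves with the
flow chosen by whether A stayed), walker B sits at `false` with mass `53/72` — for EVERY pair of kernels realising the two steps. [ours] -/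
theorem echo_bind_apply_false (hq : ∀ b, q {b} = ENNReal.ofReal 2⁻¹) (hwf : w false = 1) (hwt : w true = 2)
    (hq₁f : q₁ {false} = ENNReal.ofReal 3⁻¹) (hq₁t : q₁ {true} = ENNReal.ofReal (2 / 3)) [IsProbabilityMeasure q₁]
    (P₀ P₁ : Kernel Bool Bool)
    (hP₀ : ∀ (x : Bool) {B : Set Bool}, MeasurableSet B → P₀ x B =
      ∫⁻ y in B, imhAcceptE w x y ∂q + (1 - imhAcceptMass q w x) * B.indicator 1 x)
    (hP₁ : ∀ (x : Bool) {B : Set Bool}, MeasurableSet B → P₁ x B =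
      ∫⁻ y in B, imhAcceptE (fun _ : Bool => (3 / 2 : ℝ)) x y ∂q₁ + (1 - imhAcceptMass q₁ (fun _ : Bool => (3 / 2 : ℝ)) x) * B.indicator 1 x)
    (K₁ : Kernel (Bool × Bool) (Bool × Bool × Bool))
    (hK₁f : ∀ (a : Bool) {E : Set (Bool × Bool × Bool)}, MeasurableSet E → K₁ (a, false) E = ((P₀ a).map fun a' => (a, a', false)) E)
    (hK₁t : ∀ (a : Bool) {E : Set (Bool × Bool × Bool)}, MeasurableSet E → K₁ (a, true) E = ((P₁ a).map fun a' => (a, a', true)) E)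
    (K₂ : Kernel (Bool × Bool × Bool) Bool) (hK₂s : ∀ (a b : Bool) {B : Set Bool}, MeasurableSet B → K₂ (a, a, b) B = P₁ b B)
    (hK₂m : ∀ (a a' b : Bool) {B : Set Bool}, MeasurableSet B → a ≠ a' → K₂ (a, a', b) B = P₀ b B) :
    (((q.withDensity fun y => ENNReal.ofReal (w y)).prod (q.withDensity fun y => ENNReal.ofReal (w y))).bind (K₂ ∘ₖ K₁)) {false} =
      ENNReal.ofReal (53 / 72) := by
  obtain ⟨hπf, hπt⟩ := NaiveRetryWitness.target_eq hq hwf hwt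
  set π₂ : Measure Bool := q.withDensity fun y => ENNReal.ofReal (w y) with hπ₂
  have hs : MeasurableSet ({false} : Set Bool) := measurableSet_singleton _
  obtain ⟨eFF, eTF, eFT, eTT⟩ := EchoWitness.stepTwo_apply hq hwf hwt hq₁f hq₁t P₀ P₁ hP₀ hP₁ K₂ hK₂s hK₂m
  have hK₁f' : ∀ a, K₁ (a, false) = (P₀ a).map fun a' => (a, a', false) := fun a => Measure.ext fun E hE => hK₁f a hE
  have hK₁t' : ∀ a, K₁ (a, true) = (P₁ a).map fun a' => (a, a', true) := fun a => Measure.ext fun E hE => hK₁t a hE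
  have hmeas : ∀ a b : Bool, Measurable fun a' : Bool => (a, a', b) := fun a b => measurable_of_countable _
  -- the two-step kernel at the four starting pairs
  have hcomp : ∀ a b, (K₂ ∘ₖ K₁) (a, b) {false} = ∫⁻ z, K₂ z {false} ∂(K₁ (a, b)) := fun a b => Kernel.comp_apply' _ _ _ hs
  have cFF : (K₂ ∘ₖ K₁) (false, false) {false} = ENNReal.ofReal (5 / 12) := by
    rw [hcomp, hK₁f', lintegral_map (Kernel.measurable_coe K₂ hs) (hmeas _ _), eFF]
  have cTF : (K₂ ∘ₖ K₁) (true, false) {false} = ENNReal.ofReal (3 / 8) := by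
    rw [hcomp, hK₁f', lintegral_map (Kernel.measurable_coe K₂ hs) (hmeas _ _), eTF]
  have cFT : (K₂ ∘ₖ K₁) (false, true) {false} = ENNReal.ofReal (5 / 18) := by
    rw [hcomp, hK₁t', lintegral_map (Kernel.measurable_coe K₂ hs) (hmeas _ _), eFT]
  have cTT : (K₂ ∘ₖ K₁) (true, true) {false} = ENNReal.ofReal (11 / 36) := by
    rw [hcomp, hK₁t', lintegral_map (Kernel.measurable_coe K₂ hs) (hmeas _ _), eTT]
  have hππ : ∀ x x' : Bool, (π₂.prod π₂) {(x, x')} = π₂ {x} * π₂ {x'} := fun x x' => by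
    rw [← Set.singleton_prod_singleton, Measure.prod_prod]
  have hmff : (π₂.prod π₂) {(false, false)} = ENNReal.ofReal 4⁻¹ := by
    rw [hππ, hπf, ← ENNReal.ofReal_mul (by norm_num)]; norm_num
  have hmft : (π₂.prod π₂) {(false, true)} = ENNReal.ofReal 2⁻¹ := by rw [hππ, hπf, hπt, mul_one]
  have hmtf : (π₂.prod π₂) {(true, false)} = ENNReal.ofReal 2⁻¹ := by rw [hππ, hπf, hπt, one_mul]
  have hmtt : (π₂.prod π₂) {(true, true)} = 1 := by rw [hππ, hπt, mul_one]
  rw [Measure.bind_apply hs (Kernel.aemeasurable _), lintegral_fintype, Fintype.sum_prod_type]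
  simp only [Fintype.sum_bool, cFF, cTF, cFT, cTT, hmff, hmft, hmtf, hmtt, mul_one]
  rw [← ENNReal.ofReal_mul (by norm_num), ← ENNReal.ofReal_mul (by norm_num), ← ENNReal.ofReal_mul (by norm_num),
    ← ENNReal.ofReal_add (by norm_num) (by norm_num), ← ENNReal.ofReal_add (by norm_num) (by norm_num),
    ← ENNReal.ofReal_add (by norm_num) (by norm_num)]
  norm_num

/-- **THE EXACT VALUE IT SHOULD HAVE**: `(π ⊗ π)(Ω × {false}) = 3/4 = 54/72` — walker B's mass at `false` if B's step were exact (its law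
would still be `π`, carried by the total mass `3/2` of walker A). [ours, bookkeeping] -/
theorem echo_target_false (hq : ∀ b, q {b} = ENNReal.ofReal 2⁻¹) (hwf : w false = 1) (hwt : w true = 2) :
    ((q.withDensity fun y => ENNReal.ofReal (w y)).prod (q.withDensity fun y => ENNReal.ofReal (w y))) (Set.univ ×ˢ {false}) =
      ENNReal.ofReal (3 / 4) := by
  obtain ⟨hπf, hπt⟩ := NaiveRetryWitness.target_eq hq hwf hwt
  have huniv : (q.withDensity fun y => ENNReal.ofReal (w y)) Set.univ = ENNReal.ofReal (3 / 2) := by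
    rw [← Set.union_compl_self ({false} : Set Bool), measure_union disjoint_compl_right (measurableSet_singleton _).compl,
      show ({false} : Set Bool)ᶜ = {true} by ext b; cases b <;> simp, hπf, hπt, ← ENNReal.ofReal_one,
      ← ENNReal.ofReal_add (by norm_num) (by norm_num)]
    norm_num
  rw [Measure.prod_prod, huniv, hπf, ← ENNReal.ofReal_mul (by norm_num)]
  norm_num

/-- **THE ECHO BIASES WALKER B**: the two-step mass of `{x_B = false}` (`53/72`) is not the exact value (`54/72`), although B's choice of
flow never read B's own state and every constituent update of either walker is exact. [ours] -/
theorem echo_biased (hq : ∀ b, q {b} = ENNReal.ofReal 2⁻¹) (hwf : w false = 1) (hwt : w true = 2)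
    (hq₁f : q₁ {false} = ENNReal.ofReal 3⁻¹) (hq₁t : q₁ {true} = ENNReal.ofReal (2 / 3)) [IsProbabilityMeasure q₁]
    (P₀ P₁ : Kernel Bool Bool)
    (hP₀ : ∀ (x : Bool) {B : Set Bool}, MeasurableSet B → P₀ x B =
      ∫⁻ y in B, imhAcceptE w x y ∂q + (1 - imhAcceptMass q w x) * B.indicator 1 x)
    (hP₁ : ∀ (x : Bool) {B : Set Bool}, MeasurableSet B → P₁ x B =
      ∫⁻ y in B, imhAcceptE (fun _ : Bool => (3 / 2 : ℝ)) x y ∂q₁ + (1 - imhAcceptMass q₁ (fun _ : Bool => (3 / 2 : ℝ)) x) * B.indicator 1 x)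
    (K₁ : Kernel (Bool × Bool) (Bool × Bool × Bool))
    (hK₁f : ∀ (a : Bool) {E : Set (Bool × Bool × Bool)}, MeasurableSet E → K₁ (a, false) E = ((P₀ a).map fun a' => (a, a', false)) E)
    (hK₁t : ∀ (a : Bool) {E : Set (Bool × Bool × Bool)}, MeasurableSet E → K₁ (a, true) E = ((P₁ a).map fun a' => (a, a', true)) E)
    (K₂ : Kernel (Bool × Bool × Bool) Bool) (hK₂s : ∀ (a b : Bool) {B : Set Bool}, MeasurableSet B → K₂ (a, a, b) B = P₁ b B)
    (hK₂m : ∀ (a a' b : Bool) {B : Set Bool}, MeasurableSet B → a ≠ a' → K₂ (a, a', b) B = P₀ b B) :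
    (((q.withDensity fun y => ENNReal.ofReal (w y)).prod (q.withDensity fun y => ENNReal.ofReal (w y))).bind (K₂ ∘ₖ K₁)) {false} ≠
      ((q.withDensity fun y => ENNReal.ofReal (w y)).prod (q.withDensity fun y => ENNReal.ofReal (w y))) (Set.univ ×ˢ {false}) := by
  rw [echo_bind_apply_false hq hwf hwt hq₁f hq₁t P₀ P₁ hP₀ hP₁ K₁ hK₁f hK₁t K₂ hK₂s hK₂m, echo_target_false hq hwf hwt, Ne,
    ENNReal.ofReal_eq_ofReal_iff (by norm_num) (by norm_num)]
  norm_num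

end EchoWitness

end Summit.Ventures.LatticeQCDFlow.Exactness
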